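import Literature.AlgebraicGeometry.Modules.IsoOfSectionsOnBasis
import Summits.ResolutionOfSingularities.ResolutionOfSingularities.Theorems.HomologicalConductorNoZenoFullSheafPresentationKernel
import HarnessLib

/-!
# Crux `NoZenoR` / `NoZeno` (stmt-ResolutionOfSingularities-19943 / -16483), line `sandwich-cluster`,
# G-layer, G2: the full sheaf of the free module `T^n` IS the free sheaf `𝒪_X^n`

OURS (cell res-hironaka, chain W4.4, res-L0-w44-stub-4 for the G2 holder res-D-pv-045 AS
res-L0-w44-stub-8: the device «`(T^n)~ ≅ 𝒪_X^n` via pv-024's presentation, mono + epi» of the holder's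
A5 plan, STATUS 07:03:18Z). Nothing here is a statement of the manuscript under review (Hironaka 2017)
and nothing of `[claim: Hironaka2017]` is used; AI-written, weaker than expert review.

For `X` integral and `π : X → Spec T`, the free module `T^n` embeds into `K(X)^n` componentwise along
`baseToFunctionField π`. To serve both conventions in use (additive maps `M →+ K(X)^r` with a
semilinearity hypothesis, as in `SketchG2Split.lean`; `T`-linear maps under
`letI := (baseToFunctionField π).toAlgebra`, as in `…FullSheafEndEquiv`), the statements are made for
ANY additive `φ₀ : T^n → K(X)^n` which is componentwise the structure map
(`hφ₀ : ∀ v i, φ₀ v i = baseToFunctionField π (v i)`); the canonical choice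
`(baseToFunctionField π).toAddMonoidHom.compLeft (Fin n)` satisfies it by `rfl` (`piBase_apply`).
The full sheaf `(T^n)~ = 𝒪_X · φ₀(T^n) ⊆ K(X)^n_X` (`generatedSheaf`, p500643) receives pv-024's
presentation `𝒪_X^n ⟶ (T^n)~` attached to the standard basis vectors (p505917), and:

* `map_smul_of_componentwise`, `map_single_of_componentwise` — `φ₀` is `T`-semilinear and sends `e_k`
  to `e_k`;
* `presentation_app_injective_of_componentwise` — the presentation is injective on the sections over
  every open (coordinates on `Γ(V, 𝒪_X^n)`, p508133, and injectivity of `Γ(X, V) → K(X)` on the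
  integral `X`);
* `mono_presentation_of_componentwise`, `epi_presentation_of_componentwise` (the `σ_{e_k}` generate,
  pv-024's `span_range_ofMem_generators_eq_top`), **`isIso_presentation_of_componentwise`**
  (`X.Modules` is balanced), and the canonical instance **`isIso_presentation_piBase`**.

Everything is proved; no named facts. [this work]
-/

-- single-problem summit: the doubled namespace component `ResolutionOfSingularities` is forced
set_option linter.dupNamespace false

noncomputable section

universe u

open CategoryTheory CategoryTheory.Limits AlgebraicGeometry TopologicalSpace Opposite
open Literature.AlgebraicGeometry.Resolution Literature.AlgebraicGeometry.Morphisms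
open Literature.AlgebraicGeometry.Modules

namespace Summit.ResolutionOfSingularities.ResolutionOfSingularities.Theorems.NoZeno.SandwichCluster.FullSheaf

variable {X : Scheme.{u}} [IsIntegral X] {T : Type u} [CommRing T] (π : X ⟶ Spec (.of T)) {n : ℕ}
variable (φ₀ : (Fin n → T) →+ (Fin n → X.functionField))
  (hφ₀ : ∀ (v : Fin n → T) (i : Fin n), φ₀ v i = baseToFunctionField π (v i))

/-- The canonical componentwise structure map `T^n → K(X)^n`, pointwise. [this work] -/
@[simp]
theorem piBase_apply (n : ℕ) (v : Fin n → T) (i : Fin n) :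
    ((baseToFunctionField π).toAddMonoidHom.compLeft (Fin n)) v i = baseToFunctionField π (v i) := rfl

section Componentwise

include hφ₀

/-- A componentwise structure map `T^n → K(X)^n` is `T`-semilinear along `baseToFunctionField π`
(the convention `hφ` of the full-sheaf files). [this work] -/
theorem map_smul_of_componentwise (a : T) (v : Fin n → T) :
    φ₀ (a • v) = baseToFunctionField π a • φ₀ v := by
  funext i
  rw [hφ₀, Pi.smul_apply, Pi.smul_apply, hφ₀, smul_eq_mul, smul_eq_mul, map_mul]

/-- A componentwise structure map sends the basis vector `e_k` of `T^n` to the basis vector `e_k` of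
`K(X)^n`. [this work] -/
theorem map_single_of_componentwise (k : Fin n) :
    φ₀ (Pi.single k 1) = (Pi.single k 1 : Fin n → X.functionField) := by
  funext i
  rw [hφ₀, Pi.single_apply, Pi.single_apply]
  split_ifs <;> simp

/-- **The presentation `𝒪_X^n ⟶ (T^n)~` by the standard basis is injective on sections** over every
open `V`: a section `Σ c_k • e_k` of `𝒪_X^n` goes to the section with value `(c_k(y))_k ∈ K(X)^n` at any
`y ∈ V`, and `Γ(X, V) → K(X)` is injective (`X` integral); over an empty `V` there is nothing to prove.
[this work] -/
theorem presentation_app_injective_of_componentwise (V : X.Opens) :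
    Function.Injective ((presentation (X := X) (Fin n → X.functionField) (Set.range φ₀)
      (fun k => ⟨φ₀ (Pi.single k 1), Pi.single k 1, rfl⟩)).app V) := by
  classical
  rcases isEmpty_or_nonempty V with hVe | hVn
  · -- empty open: the source has only one section
    have hbot : V = ⊥ := le_bot_iff.mp fun x hx => (hVe.false ⟨x, hx⟩).elim
    haveI : Subsingleton Γ(freeMod X n, V) := AddCommGrpCat.subsingleton_of_isZero
      ((TopCat.Sheaf.isTerminalOfEqEmpty
        (⟨(freeMod X n).presheaf, Scheme.Modules.isSheaf (freeMod X n)⟩ : TopCat.Sheaf Ab X) hbot).isZero)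
    exact Function.injective_of_subsingleton _
  · obtain ⟨y⟩ := hVn
    refine (injective_iff_map_eq_zero _).mpr fun x hx => ?_
    obtain ⟨c, rfl⟩ := exists_coords_freeMod n V x
    -- the image section has value `(c_k(y))_k` at `y`
    have hval : fn (Fin n → X.functionField) (Set.range φ₀)
        ((presentation (X := X) (Fin n → X.functionField) (Set.range φ₀)
          (fun k => ⟨φ₀ (Pi.single k 1), Pi.single k 1, rfl⟩)).app V (∑ k, c k •
          (show (unitModule X ⟶ freeMod X n) from SheafOfModules.ιFree (ULift.up k)).app V
            (1 : Γ(X, V)))) y = fun i => evalFn V y (c i) := by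
      rw [presentation_app_sum_smul, fn_sum]
      funext i
      rw [Finset.sum_apply]
      simp_rw [fn_smul, fn_ofMem, map_single_of_componentwise π φ₀ hφ₀, Pi.smul_apply, Pi.single_apply,
        smul_eq_mul, mul_ite, mul_one, mul_zero]
      rw [Finset.sum_ite_eq, if_pos (Finset.mem_univ i)]
    have hzero : (fun i => evalFn V y (c i)) = 0 := by
      rw [← hval, hx, fn_zero]
      rfl
    have hc : ∀ i, c i = 0 := fun i => by
      apply evalFn_injective V y
      rw [map_zero]
      exact congrFun hzero i
    simp [hc]

/-- The presentation `𝒪_X^n ⟶ (T^n)~` by the standard basis is a monomorphism. [this work] -/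
theorem mono_presentation_of_componentwise :
    Mono (presentation (X := X) (Fin n → X.functionField) (Set.range φ₀)
      (fun k => ⟨φ₀ (Pi.single k 1), Pi.single k 1, rfl⟩)) :=
  mono_of_injective_app_of_isAffineOpen _ fun V _ =>
    presentation_app_injective_of_componentwise π φ₀ hφ₀ V

/-- The presentation `𝒪_X^n ⟶ (T^n)~` by the standard basis is an epimorphism (the `e_k` generate
`T^n` over `T`, so the `σ_{e_k}` generate the sections over every non-empty affine open, pv-024's
`span_range_ofMem_generators_eq_top`). [this work] -/
theorem epi_presentation_of_componentwise :
    Epi (presentation (X := X) (Fin n → X.functionField) (Set.range φ₀)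
      (fun k => ⟨φ₀ (Pi.single k 1), Pi.single k 1, rfl⟩)) := by
  refine epi_presentation _ _ _ fun U hU hne => ?_
  haveI := hne
  have hm : Submodule.span T (Set.range fun k : Fin n => (Pi.single k 1 : Fin n → T)) = ⊤ := by
    rw [show (fun k : Fin n => (Pi.single k 1 : Fin n → T)) = ⇑(Pi.basisFun T (Fin n)) from
      funext fun k => (Pi.basisFun_apply T (Fin n) k).symm]
    exact (Pi.basisFun T (Fin n)).span_eq
  exact span_range_ofMem_generators_eq_top π φ₀ (map_smul_of_componentwise π φ₀ hφ₀)
    (fun k : Fin n => (Pi.single k 1 : Fin n → T)) hm hU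

/-- **`(T^n)~ ≅ 𝒪_X^n`**: the presentation of the full sheaf of the free module `T^n` (embedded
componentwise into `K(X)^n`) by its standard basis is an isomorphism of `𝒪_X`-modules (mono + epi in the
abelian category `X.Modules`). Consumers obtain the isomorphism as `asIso (presentation …)` after
`haveI := isIso_presentation_of_componentwise π φ₀ hφ₀`. [this work] -/
theorem isIso_presentation_of_componentwise :
    IsIso (presentation (X := X) (Fin n → X.functionField) (Set.range φ₀)
      (fun k => ⟨φ₀ (Pi.single k 1), Pi.single k 1, rfl⟩)) :=
  haveI := mono_presentation_of_componentwise π φ₀ hφ₀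
  haveI := epi_presentation_of_componentwise π φ₀ hφ₀
  isIso_of_mono_of_epi _

end Componentwise

/-- **`(T^n)~ ≅ 𝒪_X^n` for the canonical embedding** `(baseToFunctionField π).toAddMonoidHom.compLeft (Fin n)`.
[this work] -/
theorem isIso_presentation_piBase (n : ℕ) :
    IsIso (presentation (X := X) (Fin n → X.functionField)
      (Set.range ((baseToFunctionField π).toAddMonoidHom.compLeft (Fin n)))
      (fun k => ⟨((baseToFunctionField π).toAddMonoidHom.compLeft (Fin n)) (Pi.single k 1),
        Pi.single k 1, rfl⟩)) :=
  isIso_presentation_of_componentwise π _ (piBase_apply π n)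

end Summit.ResolutionOfSingularities.ResolutionOfSingularities.Theorems.NoZeno.SandwichCluster.FullSheaf

end
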